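import Summits.BirchSwinnertonDyer.Rank1Residual.X12.SexticTwistFamilyPrep
import Literature.NumberTheory.EllipticCurves.KrizLi2019.HeegnerFieldSupply
import Summits.BirchSwinnertonDyer.Rank1Residual.X2.TwistTamagawa
import HarnessLib

/-!
# X12, `p = 3`, `j = 0`: Kriz–Li's sextic-twist FAMILY over `ℚ` — `BSD(E_d, 3)` for EVERY admissible `d`
# (cell `b2b-bsdres`, unit `b2b-bsdres-x1b` = X12 prover owner, gen 17; harvest-2 HARVEST E55)

HONEST FRAMING (run/shared/lean/b2b/bsd-rank1-residual/, verbatim in every file): the goal of the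
cell is to DELETE the COMBINATION-SHAPED residual classes of the Birch–Swinnerton-Dyer formula for
ALL analytic-rank `≤ 1` elliptic curves over `ℚ` — "full BSD formula for every rank `≤ 1` curve in
class `C`" assembled STRICTLY from published theorems — so that the rank-`≤ 1` remainder becomes
exactly the CONSTRUCTION-SHAPED classes, which are TYPED (missing-input `Prop`s), NOT attempted.
This is not "finishing BSD". Research route on the CONSTRUCTION-SHAPED class X12 (CM, `r_an = 1`,
`p ∣ N` non-split in the CM field); no claim beyond the stated sub-family; no label change.
THEOREMS ONLY (no definition, no new named fact in this file; the ONE new fact it consumes,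
`KrizLi2019.thm94_exists_heegnerField_h3_eq_one` = Kriz–Li 2019 Thm. 9.4, is filed next to A48 in
`Literature/NumberTheory/EllipticCurves/KrizLi2019/HeegnerFieldSupply.lean`).

## What this file proves

The X12 corner `{p = 3, j = 0, Kriz–Li sextic twists}` as ONE family theorem over `ℚ`
(`bsdp_three_sexticTwist_family`): for EVERY fundamental discriminant `d ≡ 2, 3, 5, 8 (mod 9)`
with Kriz–Li's `K`-free class-number condition (3a) — `h₃(−3d) = 1` if `d > 0`, `h₃(d) = 1` if
`d < 0` — and every globally minimal `W ≅_ℚ E_d : y² = x³ − 432d` of conductor `N` carrying a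
level-`N` modular parametrisation of Manin constant prime to `3` (Kriz–Li's hypothesis (4), the
only per-curve datum left): Miller's `BSD(E_d, 3)` (`BSDp W 3`), `Ш(E_d/ℚ)` finite,
`rank E_d(ℚ) = r_an(E_d)`, and `r_an(E_d) = 1` exactly when `d < 0, d ≡ 2 (mod 9)` or
`d > 0, d ≡ 3, 5, 8 (mod 9)` (Cor. 10.7 (2)), `= 0` otherwise (Cor. 10.7 (1), where the full
formula is Burungale–Flach's); and the same for every curve `ℚ`-isogenous to `W`
(`bsdp_three_of_isIsogenous_sexticTwist_family`, Cassels). Print states BSD(3) for `E_d` only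
OVER `K` (Thm. 1.23 = 10.10) and the rank density over `ℚ` (Cor. 10.8); the statement over `ℚ` for
the family is assembled here — a Summits result, not a Literature fact (harvest-2 E55, lit C157).

INPUTS = named facts of the tree taken as hypotheses, all PUBLISHED (no announced result):
`h` Kriz–Li Thm. 10.10 (A48), `h107` Cor. 10.7, `h94` Thm. 9.4 (first assertion, for
`(E_d, ψ_d)`; NEW), `hGZ` Gross–Zagier / Cai–Shu–Tian, `hKo` Kolyvagin, `hrat` `K`-rationality of
Heegner points (Gross 1984 / Darmon 2004) — each quantified over level, curve and field —, `hCM0`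
Burungale–Flach 2024 Cor. 2, `hmod` modularity, and for the isogeny corollary `hCassels`.
The seven per-pair records `X12SexticTwist.bsdp_three_cremona<N>_of_cor107` (harvest-1,
`Rank1Residual/X12SexticTwistTransportClosed.lean`; `d = 5, −7, 8, 12, 17, 21, 41`) carried THREE
per-pair inputs (`hDt` Manin, `hN`, `htam`) and a hand-picked `K`; here `K` comes from Thm. 9.4 and
`htam` is a theorem, so Manin (4) is the only datum, for every `d`.

## How (every per-pair input of `KrizLi2019.bsdp_three_of_thm1010` discharged class-wide)

* (c) the field: `h94` gives `K` imaginary quadratic with `d_K` odd, Heegner for `3N`, and (3b)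
  `h₃(d_K d) = 1` / `h₃(−3 d_K d) = 1`;
* (d) Heegner for `N` (divisor of `3N`) and for `3|d|`: §1 proves `ℓ ∣ d ⇒ ℓ ∣ N(W)` for every
  prime `ℓ` — `Δ(y² = x³ − 432d) = −2¹²3⁹d² = u⁻¹²·Δ_min(W)` and `12 ∤ ord_ℓ(2¹²3⁹d²)` for `ℓ ∣ d`
  (`= 2`, `11`, `16` or `18`), so `ℓ ∣ Δ_min(W)`, i.e. bad reduction (Silverman VII.5.1(a)) — the
  printed sentence "`E_d` has additive reduction exactly at the prime factors of `3d`" (§10.2),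
  inclusion `⊇`, in the kernel;
* (e) `3 ∤ #μ(K)`: `3 ∣ 3N` splits in `K` ⇒ `3 ∤ d_K` ⇒ `d_K ≠ −3` (harvest-1's
  `X12SexticTwist.not_three_dvd_torsionOrder`);
* (f) a globally minimal `Wd = Cd • W^{(d_K)}` exists (Néron) and `ord₃ u(Cd) = 0` (§2): the twisted
  equation is `3`-integral with `ord₃ Δ = ord₃ Δ(W) ≤ 11` (minimality of `W` against the displayed
  integral model), hence `3`-minimal (AEC VII.1 Rem. 1.1), and two `3`-minimal equations differ by a
  `3`-unit (AEC VII.1.3(b); eisenstein-p2's `X2.valuation_u_eq_one_of_isMinimalAt_smul`);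
* (g) `ord₃ ∏c_ℓ(Wd) = ord₃ ∏c_ℓ(W)`: eisenstein-p2's `X2.padicValNat_tamagawaProduct_twist_of_heegner_of_odd`
  (X2/TwistTamagawa.lean, Jetchev–Skinner–Wan (eq:tamK) at EVERY odd `p ∤ d_K`) applies verbatim
  at `p = 3`;
* (b) `r_an(W) = 1` resp. `0`: Cor. 10.7; (a) Heegner datum and point: Gross's
  `nonempty_heegnerDatum_holds` (PROVED) + `hrat`, through harvest-1's `exists_heegner_data`.

References: [KrizLi2019] Thm. 1.23 = 10.10, Thm. 10.6, Cor. 10.7, Thm. 9.4, Rem. 9.6, Cor. 10.8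
(Forum Math. Sigma 7 (2019) e15 = arXiv:1609.06687v3); [BurungaleFlach2024] Cor. 2;
[JetchevSkinnerWan2017] §7.4.1 (eq:tamK); [SilvermanAEC2009] VII.1 Prop. 1.3(b), Rem. 1.1, VII.5
Prop. 5.1(a), VIII.8; [Miller2011LMS] Def. 1.1; [Cassels1965ArithmeticVIII]; HOME/b2b-bsdres-x1b/
X12-ROUTE.md §21; HOME/b2b-bsdres-harvest-2/HARVEST.md §GEN-21 E55 (the mapping this file executes).
-/

noncomputable section

open scoped Classical NumberField

open WeierstrassCurve NumberField IsDedekindDomain Literature.NumberTheory.EllipticCurves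
  Literature.NumberTheory.EllipticCurves.ModularForms
  Literature.NumberTheory.EllipticCurves.KrizLi2019
  Literature.NumberTheory.EllipticCurves.Rank1Residual
  Literature.NumberTheory.EllipticCurves.Rank1Residual.X12SexticTwist

namespace Summit.BirchSwinnertonDyer.Rank1Residual.X12.SexticTwistFamily
/-! ### §4. The family theorem over `ℚ` -/

/-- **Kriz–Li's sextic twists in analytic rank one: `rank E_d(ℚ) = 1`, `Ш(E_d/ℚ)` finite and
`BSD(E_d, 3)` for EVERY `d` of Corollary 10.7 (2), from PUBLISHED theorems and ONE per-curve datum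
(Manin).** Let `d` be a fundamental discriminant with `d < 0, d ≡ 2 (mod 9)` or
`d > 0, d ≡ 3, 5, 8 (mod 9)`, with (3a) `h₃(−3d) = 1` (`d > 0`) / `h₃(d) = 1` (`d < 0`); let
`W ≅_ℚ E_d : y² = x³ − 432d` be globally minimal of conductor `N` and `Dt` a level-`N` modular
parametrisation with Manin constant `Dt.c` prime to `3` (Kriz–Li's hypothesis (4)). INPUTS, all
named facts of the tree taken as hypotheses, all PUBLISHED: Kriz–Li 2019 Thm. 10.10 (`h`),
Cor. 10.7 (`h107`), Thm. 9.4 (`h94`, the Heegner field `K` with `d_K` odd, Heegner for `3N`,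
`h₃(d₀d_K) = 1`); Gross–Zagier (`hGZ`), Kolyvagin (`hKo`), the `K`-rationality of Heegner points
(`hrat`) — each for every level, curve and field; Burungale–Flach 2024 Cor. 2 (`hCM0`);
modularity (`hmod`). Everything else is PROVED (this file + the tree): Heegner for `3|d|` and for
`N` from Heegner for `3N` (§1), the Heegner datum (Gross, `nonempty_heegnerDatum_holds`), a
globally minimal model of `E_d^{(d_K)}` (Néron), side conditions (i) Tamagawa (eisenstein-p2's
`X2.padicValNat_tamagawaProduct_twist_of_heegner_of_odd` at `p = 3`), (ii) `ord₃ u = 0` (§2),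
(iii) `3 ∤ #μ(K)` (§3), and the descent `K → ℚ` (harvest-2's `KrizLi2019.bsdp_three_of_thm1010`).
Residual class X12 (CM, `r = 1`, `p = 3` ramified in `ℚ(√−3)`), `j = 0` sextic-twist corner —
FAMILY-shaped; the class label (CONSTRUCTION-SHAPED) does not change.
[cite: KrizLi2019, Thm. 1.23 = Thm. 10.10, Cor. 10.7 (2), Thm. 9.4] [cite: BurungaleFlach2024, Cor. 2]
[cite: Miller2011LMS, Def. 1.1] -/
theorem rank_eq_one_and_bsdp_three_of_sexticTwist
    (h : thm1010_bsdThree_overK_sexticTwist) (h107 : cor107_analyticRank_sexticTwist)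
    (h94 : thm94_exists_heegnerField_h3_eq_one)
    (hGZ : ∀ (N : ℕ) [NeZero N] (W : WeierstrassCurve ℚ) (K : Type) [Field K] [NumberField K],
      gross_zagier N W K)
    (hKo : ∀ (N : ℕ) [NeZero N] (W : WeierstrassCurve ℚ) (K : Type) [Field K] [NumberField K],
      kolyvagin N W K)
    (hrat : ∀ (N : ℕ) [NeZero N] (W : WeierstrassCurve ℚ) (K : Type) [Field K] [NumberField K],
      heegnerPointComplex_mem_range_map N W K)
    (hCM0 : bsdTriple_of_hasCM_of_L_one_ne_zero) (hmod : hasEntireLFunction_rat)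
    (d : ℤ) (W : WeierstrassCurve ℚ) [W.IsElliptic] [W.IsGloballyMinimal] (N : ℕ) [NeZero N]
    (hW : ∃ C : VariableChange ℚ, C • W = ({ a₁ := 0, a₂ := 0, a₃ := 0, a₄ := 0, a₆ := -432 * d } :
      WeierstrassCurve ℚ))
    (hN : W.conductorNorm ℤ = N)
    (h1 : (d % 4 = 1 ∧ Squarefree d ∧ d ≠ 1) ∨
      (4 ∣ d ∧ (d / 4 % 4 = 2 ∨ d / 4 % 4 = 3) ∧ Squarefree (d / 4)))
    (h3a : (0 < d → ThreeClassNumberTrivial (-3 * d)) ∧ (d < 0 → ThreeClassNumberTrivial d))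
    (hcase : d < 0 ∧ d % 9 = 2 ∨ 0 < d ∧ (d % 9 = 3 ∨ d % 9 = 5 ∨ d % 9 = 8))
    (Dt : ModularParametrizationData W N) (h4 : ¬ (3 : ℤ) ∣ Dt.c) :
    W.analyticRank = 1 ∧ W.mordellWeilRank = 1 ∧ W.ShaFinite ∧ BSDp W 3 := by
  haveI : Fact (Nat.Prime 3) := ⟨Nat.prime_three⟩
  have h2 : d % 3 = 2 ∨ d % 9 = 3 := by omega
  have h9 : d % 9 = 2 ∨ d % 9 = 3 ∨ d % 9 = 5 ∨ d % 9 = 8 := by omega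
  ---------------------------------------------------------------- the Heegner field (Thm. 9.4)
  obtain ⟨K, _, _, hK, hodd, hH3N, h3bpos, h3bneg⟩ := h94 d W hW h1 h2
  have hHN' : SatisfiesHeegnerHypothesis (W.conductorNorm ℤ) K :=
    SatisfiesHeegnerHypothesis.of_dvd (dvd_mul_left _ 3) hH3N
  have hHN : SatisfiesHeegnerHypothesis N K := hN ▸ hHN'
  have hH3d : SatisfiesHeegnerHypothesis (3 * d.natAbs) K :=
    satisfiesHeegnerHypothesis_three_mul_natAbs W hW h1 hH3N
  obtain ⟨h3dK, hμ⟩ := not_three_dvd_torsionOrder_of_split hK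
    (SatisfiesHeegnerHypothesis.of_dvd (dvd_mul_right 3 _) hH3N)
  have h3pos : 0 < d → ThreeClassNumberTrivial (-3 * d) ∧
      ThreeClassNumberTrivial (NumberField.discr K * d) := fun hd => ⟨h3a.1 hd, h3bpos hd⟩
  have h3neg : d < 0 → ThreeClassNumberTrivial d ∧
      ThreeClassNumberTrivial (-3 * NumberField.discr K * d) := fun hd => ⟨h3a.2 hd, h3bneg hd⟩
  ---------------------------------------------------------------- `r_an(E_d) = 1` (Cor. 10.7 (2))
  have hr : W.analyticRank = 1 :=
    analyticRank_eq_one_of_cor107 h107 d W K hW hK hH3d h1 h2 h3pos h3neg hcase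
  ---------------------------------------------------------------- the Gross–Zagier data
  obtain ⟨H, ι, P, hP⟩ :=
    exists_heegner_data (nonempty_heegnerDatum_holds N K) (hrat N W K) hK hHN Dt
  ---------------------------------------------------------------- the twist `E_d^{(d_K)}`
  have hD0 : (NumberField.discr K : ℚ) ≠ 0 := by exact_mod_cast NumberField.discr_ne_zero K
  obtain ⟨Wd, _, _, C', hC'⟩ := exists_isGloballyMinimal_smul_eq_quadraticTwist W hD0
  have hWd : C'⁻¹ • W.quadraticTwist (NumberField.discr K : ℚ) = Wd := by
    rw [← hC', inv_smul_smul]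
  ---------------------------------------------------------------- side conditions (i), (ii)
  have htam : padicValNat 3 Wd.tamagawaProduct = padicValNat 3 W.tamagawaProduct :=
    X2.padicValNat_tamagawaProduct_twist_of_heegner_of_odd W 3 (by norm_num) K hK hodd
      (by exact_mod_cast h3dK) hHN' C'⁻¹ hWd
  have hu : padicValRat 3 (C'⁻¹.u : ℚ) = 0 :=
    padicValRat_u_eq_zero_of_smul_quadraticTwist W hW h1 (NumberField.discr_ne_zero K) h3dK Wd
      C'⁻¹ hWd
  ---------------------------------------------------------------- finiteness of `Ш(E_d/ℚ)` (Kolyvagin)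
  obtain ⟨hPinf, -, -, -⟩ := h d W N K Dt H ι P hW hN hK hH3d hP h1 h9 h3pos h3neg h4
  obtain ⟨-, hShaK⟩ := hKo N W K hK hHN ⟨Dt, H, ι, hP⟩ hPinf
  have hShaW : W.ShaFinite := shaFinite_of_baseChange W K hShaK
  ---------------------------------------------------------------- the descent
  obtain ⟨hrk, hbsd⟩ := bsdp_three_of_thm1010 d W N K Dt H ι P h (hGZ N W K) (hKo N W K) hCM0 hmod
    hW hN hK hH3d hHN hP h1 h9 h3pos h3neg h4 hr Wd C'⁻¹ hWd htam hu hμ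
  exact ⟨hr, hrk, hShaW, hbsd⟩

/-- **The companion case, Corollary 10.7 (1): `r_an(E_d) = 0`, and then the FULL BSD formula for
`E_d` is Burungale–Flach's theorem** (`L(E_d, 1) ≠ 0`, CM): `rank E_d(ℚ) = 0`, `Ш(E_d/ℚ)` finite,
`BSD(E_d, p)` for every prime `p`. Inputs: Cor. 10.7 (`h107`) and Thm. 9.4 (`h94`) for the field
`K` "in the situation of Theorem 10.6"; Burungale–Flach Cor. 2 (`hCM0`); modularity (`hmod`).
No Manin hypothesis. [cite: KrizLi2019, Cor. 10.7 (1) and Thm. 9.4] [cite: BurungaleFlach2024, Cor. 2] -/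
theorem rank_eq_zero_and_bsdp_of_sexticTwist
    (h107 : cor107_analyticRank_sexticTwist) (h94 : thm94_exists_heegnerField_h3_eq_one)
    (hCM0 : bsdTriple_of_hasCM_of_L_one_ne_zero) (hmod : hasEntireLFunction_rat)
    (d : ℤ) (W : WeierstrassCurve ℚ) [W.IsElliptic] [W.IsGloballyMinimal]
    (hW : ∃ C : VariableChange ℚ, C • W = ({ a₁ := 0, a₂ := 0, a₃ := 0, a₄ := 0, a₆ := -432 * d } :
      WeierstrassCurve ℚ))
    (h1 : (d % 4 = 1 ∧ Squarefree d ∧ d ≠ 1) ∨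
      (4 ∣ d ∧ (d / 4 % 4 = 2 ∨ d / 4 % 4 = 3) ∧ Squarefree (d / 4)))
    (h3a : (0 < d → ThreeClassNumberTrivial (-3 * d)) ∧ (d < 0 → ThreeClassNumberTrivial d))
    (hcase : 0 < d ∧ d % 9 = 2 ∨ d < 0 ∧ (d % 9 = 3 ∨ d % 9 = 5 ∨ d % 9 = 8)) :
    W.analyticRank = 0 ∧ W.mordellWeilRank = 0 ∧ W.ShaFinite ∧ ∀ p : ℕ, p.Prime → BSDp W p := by
  have h2 : d % 3 = 2 ∨ d % 9 = 3 := by omega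
  obtain ⟨K, _, _, hK, -, hH3N, h3bpos, h3bneg⟩ := h94 d W hW h1 h2
  have hH3d : SatisfiesHeegnerHypothesis (3 * d.natAbs) K :=
    satisfiesHeegnerHypothesis_three_mul_natAbs W hW h1 hH3N
  have h3pos : 0 < d → ThreeClassNumberTrivial (-3 * d) ∧
      ThreeClassNumberTrivial (NumberField.discr K * d) := fun hd => ⟨h3a.1 hd, h3bpos hd⟩
  have h3neg : d < 0 → ThreeClassNumberTrivial d ∧
      ThreeClassNumberTrivial (-3 * NumberField.discr K * d) := fun hd => ⟨h3a.2 hd, h3bneg hd⟩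
  have hr : W.analyticRank = 0 :=
    (analyticRank_eq_zero_of_cor107 h107 d W K hW hK hH3d h1 h2 h3pos h3neg hcase).1
  have hL : W.entireLFunction 1 ≠ 0 := (W.analyticRank_eq_zero_iff_holds (hmod W)).1 hr
  have hBSD : W.BSDTriple := hCM0 W (hasCM_of_sextic W hW) hL
  obtain ⟨hrank, hsha, -⟩ := (bsdTriple_iff W).1 hBSD
  exact ⟨hr, by rw [← hrank, hr], hsha, fun p hp => forall_bsdp_of_bsdTriple' W hBSD p hp⟩

/-- **THE FAMILY THEOREM: `BSD(E_d, 3)` over `ℚ` for every member of Kriz–Li's sextic-twist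
family.** For every fundamental discriminant `d ≡ 2, 3, 5, 8 (mod 9)` with (3a) `h₃(−3d) = 1`
(`d > 0`) / `h₃(d) = 1` (`d < 0`), and every globally minimal `W ≅_ℚ E_d : y² = x³ − 432d` of
conductor `N` admitting a level-`N` parametrisation of Manin constant prime to `3` (Kriz–Li's (4);
Cremona/ARS 2006 per curve): Miller's `BSD(E_d, 3)` holds, `Ш(E_d/ℚ)` is finite,
`rank E_d(ℚ) = r_an(E_d)`, and `r_an(E_d) = 1` exactly in Corollary 10.7's case (2) (else `0`).
Assembled from the PUBLISHED inputs listed in `rank_eq_one_and_bsdp_three_of_sexticTwist` /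
`rank_eq_zero_and_bsdp_of_sexticTwist`; the rank-one half is Kriz–Li Thm. 10.10 over `K`
descended to `ℚ`, the rank-zero half is Burungale–Flach. This is the sub-family statement the
cell's RESIDUAL-CASES §a.2 records as "X12, `p = 3`, `j = 0` sextic-twist sub-family —
FAMILY-shaped, closed in print"; the seven window records
`X12SexticTwist.bsdp_three_cremona<N>_of_cor107` (`225a, 1323m, 1728a, 3888t, 7803b, 11907s,
15129a`) are its instances `d = 5, −7, 8, 12, 17, 21, 41`.
[cite: KrizLi2019, Thm. 1.23 = Thm. 10.10, Cor. 10.7, Thm. 9.4] [cite: BurungaleFlach2024, Cor. 2]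
[cite: Miller2011LMS, Def. 1.1] -/
theorem bsdp_three_sexticTwist_family
    (h : thm1010_bsdThree_overK_sexticTwist) (h107 : cor107_analyticRank_sexticTwist)
    (h94 : thm94_exists_heegnerField_h3_eq_one)
    (hGZ : ∀ (N : ℕ) [NeZero N] (W : WeierstrassCurve ℚ) (K : Type) [Field K] [NumberField K],
      gross_zagier N W K)
    (hKo : ∀ (N : ℕ) [NeZero N] (W : WeierstrassCurve ℚ) (K : Type) [Field K] [NumberField K],
      kolyvagin N W K)
    (hrat : ∀ (N : ℕ) [NeZero N] (W : WeierstrassCurve ℚ) (K : Type) [Field K] [NumberField K],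
      heegnerPointComplex_mem_range_map N W K)
    (hCM0 : bsdTriple_of_hasCM_of_L_one_ne_zero) (hmod : hasEntireLFunction_rat)
    (d : ℤ) (W : WeierstrassCurve ℚ) [W.IsElliptic] [W.IsGloballyMinimal] (N : ℕ) [NeZero N]
    (hW : ∃ C : VariableChange ℚ, C • W = ({ a₁ := 0, a₂ := 0, a₃ := 0, a₄ := 0, a₆ := -432 * d } :
      WeierstrassCurve ℚ))
    (hN : W.conductorNorm ℤ = N)
    (h1 : (d % 4 = 1 ∧ Squarefree d ∧ d ≠ 1) ∨
      (4 ∣ d ∧ (d / 4 % 4 = 2 ∨ d / 4 % 4 = 3) ∧ Squarefree (d / 4)))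
    (h9 : d % 9 = 2 ∨ d % 9 = 3 ∨ d % 9 = 5 ∨ d % 9 = 8)
    (h3a : (0 < d → ThreeClassNumberTrivial (-3 * d)) ∧ (d < 0 → ThreeClassNumberTrivial d))
    (Dt : ModularParametrizationData W N) (h4 : ¬ (3 : ℤ) ∣ Dt.c) :
    BSDp W 3 ∧ W.ShaFinite ∧ W.mordellWeilRank = W.analyticRank ∧
      (W.analyticRank = 1 ↔ (d < 0 ∧ d % 9 = 2 ∨ 0 < d ∧ (d % 9 = 3 ∨ d % 9 = 5 ∨ d % 9 = 8))) := by
  have hd0 : d ≠ 0 := Literature.NumberTheory.QuadraticFields.Quadratic.ne_zero_of_isFundamental h1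
  by_cases hcase : d < 0 ∧ d % 9 = 2 ∨ 0 < d ∧ (d % 9 = 3 ∨ d % 9 = 5 ∨ d % 9 = 8)
  · obtain ⟨hr, hrk, hsha, hbsd⟩ := rank_eq_one_and_bsdp_three_of_sexticTwist h h107 h94 hGZ hKo
      hrat hCM0 hmod d W N hW hN h1 h3a hcase Dt h4
    exact ⟨hbsd, hsha, by rw [hrk, hr], iff_of_true hr hcase⟩
  · have hcase' : 0 < d ∧ d % 9 = 2 ∨ d < 0 ∧ (d % 9 = 3 ∨ d % 9 = 5 ∨ d % 9 = 8) := by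
      rcases lt_or_gt_of_ne hd0 with hneg | hpos
      · right; exact ⟨hneg, by omega⟩
      · left; exact ⟨hpos, by omega⟩
    obtain ⟨hr, hrk, hsha, hbsd⟩ := rank_eq_zero_and_bsdp_of_sexticTwist h107 h94 hCM0 hmod d W
      hW h1 h3a hcase'
    exact ⟨hbsd 3 Nat.prime_three, hsha, by rw [hrk, hr], iff_of_false (by omega) hcase⟩

/-- **Every curve `ℚ`-isogenous to a member of the family satisfies `BSD(·, 3)` too** (Cassels
1965: the truth of the BSD formula is isogeny-invariant; tree theorem
`Wuthrich2014.bsdp_of_isIsogenous`, one more PUBLISHED binder `hCassels`) — e.g. the Cremona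
curves `225a1 ~ 225a2 ≅ E_5`, …, of the seven window records. [cite: Cassels1965ArithmeticVIII]
[cite: MilneADT2006, Thm I.7.3] [cite: KrizLi2019, Thm. 1.23 = Thm. 10.10] -/
theorem bsdp_three_of_isIsogenous_sexticTwist_family
    (h : thm1010_bsdThree_overK_sexticTwist) (h107 : cor107_analyticRank_sexticTwist)
    (h94 : thm94_exists_heegnerField_h3_eq_one)
    (hGZ : ∀ (N : ℕ) [NeZero N] (W : WeierstrassCurve ℚ) (K : Type) [Field K] [NumberField K],
      gross_zagier N W K)
    (hKo : ∀ (N : ℕ) [NeZero N] (W : WeierstrassCurve ℚ) (K : Type) [Field K] [NumberField K],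
      kolyvagin N W K)
    (hrat : ∀ (N : ℕ) [NeZero N] (W : WeierstrassCurve ℚ) (K : Type) [Field K] [NumberField K],
      heegnerPointComplex_mem_range_map N W K)
    (hCM0 : bsdTriple_of_hasCM_of_L_one_ne_zero) (hmod : hasEntireLFunction_rat)
    (hCassels : bsdRHS_eq_of_isIsogenous)
    (d : ℤ) (W : WeierstrassCurve ℚ) [W.IsElliptic] [W.IsGloballyMinimal] (N : ℕ) [NeZero N]
    (hW : ∃ C : VariableChange ℚ, C • W = ({ a₁ := 0, a₂ := 0, a₃ := 0, a₄ := 0, a₆ := -432 * d } :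
      WeierstrassCurve ℚ))
    (hN : W.conductorNorm ℤ = N)
    (h1 : (d % 4 = 1 ∧ Squarefree d ∧ d ≠ 1) ∨
      (4 ∣ d ∧ (d / 4 % 4 = 2 ∨ d / 4 % 4 = 3) ∧ Squarefree (d / 4)))
    (h9 : d % 9 = 2 ∨ d % 9 = 3 ∨ d % 9 = 5 ∨ d % 9 = 8)
    (h3a : (0 < d → ThreeClassNumberTrivial (-3 * d)) ∧ (d < 0 → ThreeClassNumberTrivial d))
    (Dt : ModularParametrizationData W N) (h4 : ¬ (3 : ℤ) ∣ Dt.c)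
    (W₁ : WeierstrassCurve ℚ) [W₁.IsElliptic] [W₁.IsGloballyMinimal] (hiso : IsIsogenous W₁ W) :
    BSDp W₁ 3 ∧ (W₁.analyticRank = 1 ↔
      (d < 0 ∧ d % 9 = 2 ∨ 0 < d ∧ (d % 9 = 3 ∨ d % 9 = 5 ∨ d % 9 = 8))) := by
  haveI : Fact (Nat.Prime 3) := ⟨Nat.prime_three⟩
  obtain ⟨hbsd, hsha, -, hiff⟩ := bsdp_three_sexticTwist_family h h107 h94 hGZ hKo hrat hCM0 hmod d
    W N hW hN h1 h9 h3a Dt h4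
  haveI : Finite W.sha := hsha
  refine ⟨Wuthrich2014.bsdp_of_isIsogenous hCassels hiso hsha
    (W.leadingLCoeff_ne_zero_holds (hmod W)) hbsd, ?_⟩
  rw [analyticRank_eq_of_isIsogenous' hiso]
  exact hiff

/-! ### §5. A window record as an instance: class `225a` (`d = 5`) with TWO per-pair data -/

/-- **`225a` from the family theorem** — harvest-1's record
`X12SexticTwist.bsdp_three_cremona225a_of_cor107` re-derived with its Tamagawa side condition
`htam` DISCHARGED (a theorem now) and its hand-picked field `ℚ(√−11)` replaced by Theorem 9.4's:
the only per-pair inputs are a level-`225` parametrisation of `225a2 ≅ E_5` with Manin constant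
prime to `3` (`hDt`) and `N(225a2) = 225` (`hN`); `d = 5 > 0`, `5 ≡ 5 (mod 9)`, (3a)
`h₃(−15) = 1` is the tree theorem `threeClassNumberTrivial_neg15`; `225a1 ~ 225a2` by Cassels.
[cite: KrizLi2019, Thm. 1.23 = Thm. 10.10 and Cor. 10.7 (2)] [cite: Cremona1997, Table 1 (class 225a)] -/
theorem bsdp_three_cremona225a_of_family
    (h : thm1010_bsdThree_overK_sexticTwist) (h107 : cor107_analyticRank_sexticTwist)
    (h94 : thm94_exists_heegnerField_h3_eq_one)
    (hGZ : ∀ (N : ℕ) [NeZero N] (W : WeierstrassCurve ℚ) (K : Type) [Field K] [NumberField K],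
      gross_zagier N W K)
    (hKo : ∀ (N : ℕ) [NeZero N] (W : WeierstrassCurve ℚ) (K : Type) [Field K] [NumberField K],
      kolyvagin N W K)
    (hrat : ∀ (N : ℕ) [NeZero N] (W : WeierstrassCurve ℚ) (K : Type) [Field K] [NumberField K],
      heegnerPointComplex_mem_range_map N W K)
    (hCM0 : bsdTriple_of_hasCM_of_L_one_ne_zero) (hmod : hasEntireLFunction_rat)
    (hCassels : bsdRHS_eq_of_isIsogenous)
    (hDt : ∃ Dt : ModularParametrizationData cremona225a2 225, ¬ (3 : ℤ) ∣ Dt.c)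
    (hN : cremona225a2.conductorNorm ℤ = 225) :
    (BSDp cremona225a2 3 ∧ cremona225a2.ShaFinite ∧ cremona225a2.analyticRank = 1) ∧
      (BSDp cremona225a1 3 ∧ cremona225a1.analyticRank = 1) := by
  haveI : NeZero (225 : ℕ) := ⟨by norm_num⟩
  obtain ⟨Dt, h4⟩ := hDt
  have h1 : ((5 : ℤ) % 4 = 1 ∧ Squarefree (5 : ℤ) ∧ (5 : ℤ) ≠ 1) ∨
      (4 ∣ (5 : ℤ) ∧ ((5 : ℤ) / 4 % 4 = 2 ∨ (5 : ℤ) / 4 % 4 = 3) ∧ Squarefree ((5 : ℤ) / 4)) :=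
    Or.inl ⟨by norm_num, by exact_mod_cast squarefree_intCast_of_prime (by norm_num : Nat.Prime 5),
      by norm_num⟩
  have h9 : (5 : ℤ) % 9 = 2 ∨ (5 : ℤ) % 9 = 3 ∨ (5 : ℤ) % 9 = 5 ∨ (5 : ℤ) % 9 = 8 := by norm_num
  have h3a : (0 < (5 : ℤ) → ThreeClassNumberTrivial (-3 * 5)) ∧
      ((5 : ℤ) < 0 → ThreeClassNumberTrivial 5) :=
    ⟨fun _ => by norm_num; exact threeClassNumberTrivial_neg15, fun h => absurd h (by norm_num)⟩
  obtain ⟨hbsd, hsha, -, hiff⟩ := bsdp_three_sexticTwist_family h h107 h94 hGZ hKo hrat hCM0 hmod 5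
    cremona225a2 225 cremona225a2_eq hN h1 h9 h3a Dt h4
  obtain ⟨hbsd1, hiff1⟩ := bsdp_three_of_isIsogenous_sexticTwist_family h h107 h94 hGZ hKo hrat hCM0
    hmod hCassels 5 cremona225a2 225 cremona225a2_eq hN h1 h9 h3a Dt h4 cremona225a1
    isIsogenous_cremona225a
  have hcase : (5 : ℤ) < 0 ∧ (5 : ℤ) % 9 = 2 ∨
      0 < (5 : ℤ) ∧ ((5 : ℤ) % 9 = 3 ∨ (5 : ℤ) % 9 = 5 ∨ (5 : ℤ) % 9 = 8) := by norm_num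
  exact ⟨⟨hbsd, hsha, hiff.mpr hcase⟩, hbsd1, hiff1.mpr hcase⟩

/-! ### §6. The rendering of Theorem 9.4 (3) for `3 ∣ d` is print's `h₃(−d·d_K/3) = 1`: same field -/

/-- `h₃` only depends on the quadratic field: `ThreeClassNumberTrivial (n²·D) ↔ ThreeClassNumberTrivial D`
for `n ≠ 0` (`x² = D ↔ (n x)² = n² D` in characteristic `0`). [folklore] -/
theorem threeClassNumberTrivial_sq_mul_iff {n : ℤ} (hn : n ≠ 0) (D : ℤ) :
    ThreeClassNumberTrivial (n ^ 2 * D) ↔ ThreeClassNumberTrivial D := by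
  constructor
  · intro h F _ _ h2 hx
    obtain ⟨x, hx⟩ := hx
    exact h F h2 ⟨(n : F) * x, by push_cast; rw [mul_pow, hx]⟩
  · intro h F _ _ h2 hy
    obtain ⟨y, hy⟩ := hy
    have hn' : (n : F) ≠ 0 := by exact_mod_cast hn
    refine h F h2 ⟨y / (n : F), ?_⟩
    rw [div_pow, hy]
    push_cast
    field_simp

/-- For `3 ∣ d`, Kriz–Li's printed condition `h₃(d₀ d_K) = 1` with `d₀ = −d/3` and the tree's
rendering `ThreeClassNumberTrivial (−3·d_K·d)` (hypothesis (3b) of Theorem 10.10 for `d < 0`)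
are the same statement: `−3·d_K·d = 3²·(−(d/3)·d_K)`. [cite: KrizLi2019, Thm. 9.4 (definition of d₀)] -/
theorem threeClassNumberTrivial_neg_three_mul_iff_of_three_dvd {d : ℤ} (hd : (3 : ℤ) ∣ d) (D : ℤ) :
    ThreeClassNumberTrivial (-3 * D * d) ↔ ThreeClassNumberTrivial (-(d / 3) * D) := by
  obtain ⟨e, rfl⟩ := hd
  have he : (3 * e) / 3 = e := by omega
  rw [he, show (-3 * D * (3 * e) : ℤ) = 3 ^ 2 * (-e * D) by ring]
  exact threeClassNumberTrivial_sq_mul_iff (by norm_num) _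

end Summit.BirchSwinnertonDyer.Rank1Residual.X12.SexticTwistFamily

end
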